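import Literature.Geometry.Riemannian.LevelSetMeanCurvature
import Literature.Geometry.Riemannian.RiemannianDistance
import Literature.Geometry.Lorentzian.Volume
import Literature.Geometry.Lorentzian.LeviCivitaProofs
import Literature.Geometry.Lorentzian.CurvatureProofs
import Literature.Geometry.Lorentzian.EnergyCurrents
import Mathlib.Analysis.SpecialFunctions.Gaussian.FourierTransform
import Mathlib.Analysis.Complex.ExponentialBounds
import Mathlib.Analysis.Real.Pi.Bounds
import Mathlib.Analysis.SpecialFunctions.Pow.Real
import HarnessLib

/-!
# The Gaussian shrinker `(ℝⁿ, δ, |x|²/4)` in the tree's vocabulary (topic `Geometry/Riemannian`)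

The flat Gaussian soliton — Euclidean space with potential `f = |x|²/4` — is the trivial gradient
shrinking Ricci soliton: `Ric + Hess f = ½ δ`, `R + |∇f|² = f`, Gaussian density
`Θ = (4π)^{-n/2} ∫ e^{-f} dx = 1` (Cao–Hamilton–Ilmanen 2004, §4, observation (1) and the table:
`Θ(ℝ⁴) = 1`). This file evaluates every clause of that sentence in the tree's own vocabulary
(`PseudoRiemannianMetric.leviCivita/ricci/scalarCurvature/hessian/gradSq/edist`,
`Lorentzian.riemannianMeasure`) for `euclideanMetric W` (`RoundSphere.lean`):

* `isFlat_leviCivita_euclideanMetric`, `ricci_euclideanMetric`, `scalarCurvature_euclideanMetric` — the Koszul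
  connection of the Euclidean metric is flat (O'Neill 1983, Ch. 3, Lemma 3.14 and p. 80);
* `hessian_gaussianPotential : Hess(|x|²/4)(X,Y) = ⟪X,Y⟫/2`, `gradSq_gaussianPotential : |∇f|² = f`;
* `edist_euclideanMetric` (the Riemannian distance is the Euclidean one), `isCompact_setOf_edist_euclideanMetric_le`;
* in dimension 4 (`EuclideanFour = EuclideanSpace ℝ (Fin 4)`): `riemannianMeasure_euclideanFour : dV_δ = dx`
  (Federer 1969, §3.2.46), `lintegral_exp_neg_gaussianPotential : ∫⁻ e^{-|x|²/4} dx = 16π²`, and the comparison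
  `cylinderDensityBound_lt_gaussian : 32π²√π e^{-3/2} < 16π²` (`Θ(S³×ℝ) = .791 < 1`).

Used by the refuter's negative lemma for crux `EntropyRung.NoncompactShrinkerGap`
(SmoothPoincare4): the crux minus non-flatness is false. Everything is proved; no named facts.

## References

* H.-D. Cao, R. S. Hamilton, T. Ilmanen, *Gaussian densities and stability for some Ricci
  solitons*, arXiv:math/0404165 (2004), §4. [CaoHamiltonIlmanen2004]
* B. O'Neill, *Semi-Riemannian geometry*, Academic Press 1983, Ch. 3, Lemma 3.14, p. 80. [ONeill1983]
* H. Federer, *Geometric Measure Theory*, Springer 1969, §2.10.2, §3.2.46. [Federer1969]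
-/

noncomputable section

open Bundle Set Function Filter Manifold
open scoped Manifold ContDiff Topology RealInnerProductSpace ENNReal NNReal

namespace Literature.Geometry.Riemannian

open Lorentzian Lorentzian.PseudoRiemannianMetric

section General

variable {W : Type*} [NormedAddCommGroup W] [InnerProductSpace ℝ W] [FiniteDimensional ℝ W]
  [CompleteSpace W]

/-- The Euclidean metric has its Levi-Civita connection (the tree's general existence theorem
`PseudoRiemannianMetric.hasLeviCivita`). [folklore] -/
instance instHasLeviCivitaEuclideanMetric : (euclideanMetric W).HasLeviCivita :=
  (euclideanMetric W).hasLeviCivita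

omit [FiniteDimensional ℝ W] [CompleteSpace W] in
/-- `mvfderiv` on a vector space is `fderiv` (private copy of the lemma of the same name in
`TransportedCutoff.lean`, to keep this file's import cone small). [folklore] -/
private theorem mvfderiv_vectorSpace_apply {F : Type*} [NormedAddCommGroup F] [NormedSpace ℝ F]
    (f : W → F) (x v : W) :
    mvfderiv 𝓘(ℝ, W) f x v = fderiv ℝ f x v := by
  simp only [mvfderiv, mfderiv_eq_fderiv]
  rfl

/-- The Levi-Civita connection of the Euclidean metric kills constant fields (`∇_X Y₀ = dY₀(X) = 0`;
O'Neill 1983, Ch. 3, Lemma 3.14). [folklore] -/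
theorem leviCivita_euclideanMetric_const (x X₀ Y₀ : W) :
    (euclideanMetric W).leviCivita (fun _ : W ↦ (Y₀ : W)) x X₀ = 0 := by
  rw [leviCivita_euclideanMetric_apply (contMDiffAt_section_of_contDiffAt contDiffAt_const)]
  rw [mvfderiv_const]
  rfl

/-- **Euclidean space is flat**: the curvature tensor of the Levi-Civita (Koszul) connection of the
Euclidean metric vanishes (computed on constant fields via `curvature_apply_holds`). [folklore] -/
theorem isFlat_leviCivita_euclideanMetric : (euclideanMetric W).leviCivita.IsFlat := by
  rw [CovariantDerivative.isFlat_iff]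
  intro x X₀ Y₀ Z₀
  have hcov : (euclideanMetric W).leviCivita.IsLocallyContMDiff 1 :=
    (euclideanMetric W).isLocallyContMDiff_leviCivita_holds 1 (by exact_mod_cast le_top)
  set Xc : Π y : W, TangentSpace 𝓘(ℝ, W) y := fun _ ↦ (X₀ : W) with hXc
  set Yc : Π y : W, TangentSpace 𝓘(ℝ, W) y := fun _ ↦ (Y₀ : W) with hYc
  set Zc : Π y : W, TangentSpace 𝓘(ℝ, W) y := fun _ ↦ (Z₀ : W) with hZc
  have hX : MDiffAt (T% Xc) x :=
    (contMDiffAt_section_of_contDiffAt (k := 1) contDiffAt_const).mdifferentiableAt one_ne_zero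
  have hY : MDiffAt (T% Yc) x :=
    (contMDiffAt_section_of_contDiffAt (k := 1) contDiffAt_const).mdifferentiableAt one_ne_zero
  have hZ : CMDiffAt (minSmoothness ℝ 2) (T% Zc) x :=
    contMDiffAt_section_of_contDiffAt contDiffAt_const
  have key := CovariantDerivative.curvature_apply_holds (cov := (euclideanMetric W).leviCivita)
    (x := x) hcov hX hY hZ
  rw [show X₀ = Xc x from rfl, show Y₀ = Yc x from rfl, show Z₀ = Zc x from rfl, key]
  simp only [CovariantDerivative.curvatureAux, hXc, hYc, hZc, leviCivita_euclideanMetric_const]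
  have h0 : ∀ v : W,
      (euclideanMetric W).leviCivita (fun y : W ↦ (0 : TangentSpace 𝓘(ℝ, W) y)) x v = 0 :=
    fun v ↦ leviCivita_euclideanMetric_const x v 0
  rw [h0, h0]
  simp

/-- The Ricci tensor of Euclidean space vanishes. [folklore] -/
theorem ricci_euclideanMetric (x : W) : (euclideanMetric W).ricci x = 0 :=
  (euclideanMetric W).leviCivita.ricci_eq_zero_of_isFlat isFlat_leviCivita_euclideanMetric x

/-- The scalar curvature of Euclidean space vanishes. [folklore] -/
theorem scalarCurvature_euclideanMetric (x : W) : (euclideanMetric W).scalarCurvature x = 0 := by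
  simp [PseudoRiemannianMetric.scalarCurvature, ricci_euclideanMetric, PseudoRiemannianMetric.trace]

/-- The Gaussian shrinker potential `f(x) = |x|² / 4` on a real inner product space. [folklore] -/
def gaussianPotential (x : W) : ℝ := ‖x‖ ^ 2 / 4

omit [FiniteDimensional ℝ W] [CompleteSpace W] in
/-- The Gaussian potential is smooth. [folklore] -/
theorem contDiff_gaussianPotential : ContDiff ℝ ∞ (gaussianPotential : W → ℝ) :=
  (contDiff_norm_sq ℝ).div_const 4

omit [FiniteDimensional ℝ W] [CompleteSpace W] in
/-- `d(|x|²/4)_y = ½ ⟪y, ·⟫`. [folklore] -/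
theorem hasFDerivAt_gaussianPotential (y : W) :
    HasFDerivAt (gaussianPotential : W → ℝ) ((2 : ℝ)⁻¹ • innerSL ℝ y) y := by
  have h1 : HasFDerivAt (fun x : W ↦ ‖x‖ ^ 2) (2 • innerSL ℝ y) y :=
    (hasStrictFDerivAt_norm_sq y).hasFDerivAt
  have h2 := h1.const_mul (4 : ℝ)⁻¹
  have hfun : (gaussianPotential : W → ℝ) = fun x ↦ (4 : ℝ)⁻¹ * ‖x‖ ^ 2 := by
    funext x; simp only [gaussianPotential]; ring
  rw [hfun]
  refine h2.congr_fderiv ?_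
  ext v
  simp only [smul_apply, innerSL_apply_apply, smul_eq_mul, nsmul_eq_mul, Nat.cast_ofNat]
  ring

omit [FiniteDimensional ℝ W] [CompleteSpace W] in
/-- `d(|x|²/4)_y (v) = ⟪y, v⟫ / 2`. [folklore] -/
theorem fderiv_gaussianPotential_apply (y v : W) : fderiv ℝ (gaussianPotential : W → ℝ) y v = ⟪y, v⟫ / 2 := by
  rw [(hasFDerivAt_gaussianPotential y).fderiv, smul_apply, innerSL_apply_apply, smul_eq_mul]
  ring

omit [FiniteDimensional ℝ W] [CompleteSpace W] in
/-- The manifold differential of the Gaussian potential: `df_y (v) = ⟪y, v⟫ / 2`. [folklore] -/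
theorem mvfderiv_gaussianPotential_apply (y v : W) : mvfderiv 𝓘(ℝ, W) (gaussianPotential : W → ℝ) y v = ⟪y, v⟫ / 2 := by
  rw [mvfderiv_vectorSpace_apply, fderiv_gaussianPotential_apply]

/-- **The Hessian of the Gaussian potential is half the metric**: `Hess(|x|²/4)(X, Y) = ⟪X, Y⟫/2`
(tree Hessian `hessian_apply_holds` on constant fields, `∇_X Y₀ = 0`). [folklore] -/
theorem hessian_gaussianPotential (x X₀ Y₀ : W) :
    (euclideanMetric W).hessian gaussianPotential x X₀ Y₀ = ⟪X₀, Y₀⟫ / 2 := by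
  have h2 : ContDiff ℝ 2 (gaussianPotential : W → ℝ) := (contDiff_gaussianPotential (W := W)).of_le (by norm_cast)
  have hf : CMDiffAt 2 (gaussianPotential : W → ℝ) x := h2.contMDiff.contMDiffAt
  set Xc : Π y : W, TangentSpace 𝓘(ℝ, W) y := fun _ ↦ (X₀ : W) with hXc
  set Yc : Π y : W, TangentSpace 𝓘(ℝ, W) y := fun _ ↦ (Y₀ : W) with hYc
  have hX : MDiffAt (T% Xc) x :=
    (contMDiffAt_section_of_contDiffAt (k := 1) contDiffAt_const).mdifferentiableAt one_ne_zero
  have hY : MDiffAt (T% Yc) x :=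
    (contMDiffAt_section_of_contDiffAt (k := 1) contDiffAt_const).mdifferentiableAt one_ne_zero
  have key := (euclideanMetric W).hessian_apply_holds hf hX hY
  rw [show X₀ = Xc x from rfl, show Y₀ = Yc x from rfl, key, PseudoRiemannianMetric.hessianAux]
  simp only [hXc, hYc, leviCivita_euclideanMetric_const, map_zero, sub_zero]
  have hfun : (fun y : W ↦ mvfderiv 𝓘(ℝ, W) (gaussianPotential : W → ℝ) y Y₀) =
      fun y ↦ (((2 : ℝ)⁻¹ • innerSL ℝ (Y₀ : W) : W →L[ℝ] ℝ)) y := by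
    funext y
    rw [mvfderiv_gaussianPotential_apply, smul_apply, innerSL_apply_apply, real_inner_comm, smul_eq_mul]
    ring
  rw [hfun, mvfderiv_vectorSpace_apply, ContinuousLinearMap.fderiv, smul_apply, innerSL_apply_apply,
    real_inner_comm, smul_eq_mul]
  ring

omit [CompleteSpace W] in
/-- **`|∇f|² = f` for the Gaussian potential**: `g⁻¹(df, df) = |x|²/4` (`♯ df = x/2`). [folklore] -/
theorem gradSq_gaussianPotential (x : W) : (euclideanMetric W).gradSq gaussianPotential x = gaussianPotential x := by
  rw [PseudoRiemannianMetric.gradSq_eq]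
  set α : TangentSpace 𝓘(ℝ, W) x →L[ℝ] ℝ := mvfderiv 𝓘(ℝ, W) (gaussianPotential : W → ℝ) x with hα
  set s : W := (euclideanMetric W).sharp x (α : TangentSpace 𝓘(ℝ, W) x →ₗ[ℝ] ℝ) with hs
  have hsw : ∀ w : W, ⟪s, w⟫ = ⟪x, w⟫ / 2 := fun w ↦ by
    have h1 := (euclideanMetric W).val_sharp_apply x (α : TangentSpace 𝓘(ℝ, W) x →ₗ[ℝ] ℝ) w
    rw [euclideanMetric_apply] at h1
    have h2 : (α : TangentSpace 𝓘(ℝ, W) x →ₗ[ℝ] ℝ) w = ⟪x, w⟫ / 2 := mvfderiv_gaussianPotential_apply x w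
    exact h1.trans h2
  have hs2 : s = (2 : ℝ)⁻¹ • x := by
    apply ext_inner_right ℝ
    intro w
    rw [hsw, real_inner_smul_left]
    ring
  change α s = gaussianPotential x
  rw [hα, mvfderiv_gaussianPotential_apply, hs2, real_inner_smul_right, real_inner_self_eq_norm_sq, gaussianPotential]
  ring


/-! ### Stage E: distance and completeness -/

omit [CompleteSpace W] in
/-- The tree's Riemannian distance of the Euclidean metric is the Euclidean distance (Mathlib's
`IsRiemannianManifold 𝓘(ℝ, W) W`; the bundle structures agree definitionally). [folklore] -/
theorem edist_euclideanMetric (x y : W) :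
    (euclideanMetric W).edist isRiemannian_euclideanMetric x y = edist x y := by
  rw [IsRiemannianManifold.out (I := 𝓘(ℝ, W)) x y]
  rfl

omit [CompleteSpace W] in
/-- **Euclidean space is complete in the crux's sense**: closed `g`-balls are compact (they are the
closed Euclidean balls of a finite-dimensional space). [folklore] -/
theorem isCompact_setOf_edist_euclideanMetric_le (x : W) (r : NNReal) :
    IsCompact {y : W | (euclideanMetric W).edist isRiemannian_euclideanMetric x y ≤ r} := by
  have hset : {y : W | (euclideanMetric W).edist isRiemannian_euclideanMetric x y ≤ r} =
      Metric.closedBall x r := by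
    ext y
    rw [mem_setOf_eq, edist_euclideanMetric, Metric.mem_closedBall, PseudoEMetricSpace.edist_comm, edist_le_coe,
      ← NNReal.coe_le_coe, coe_nndist]
  rw [hset]
  exact isCompact_closedBall x r

/-! ### Stage F: the Riemannian measure of Euclidean `ℝ⁴` is Lebesgue measure -/

section EuclideanFour

open MeasureTheory Measure

/-- Euclidean `ℝ⁴ = EuclideanSpace ℝ (Fin 4)`, the crux's chart model, as a manifold modelled on
itself. [folklore] -/
abbrev EuclideanFour : Type := EuclideanSpace ℝ (Fin 4)

/-- Two emetric structures with the same distance function have the same Hausdorff measures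
(transport along the identity, an isometry; Federer 1969, §2.10.2). [folklore] -/
theorem hausdorffMeasure_eq_of_edist_eq {X : Type*} (i₁ i₂ : EMetricSpace X) [m : MeasurableSpace X]
    (b₁ : @BorelSpace X (@UniformSpace.toTopologicalSpace X
      (@PseudoEMetricSpace.toUniformSpace X (@EMetricSpace.toPseudoEMetricSpace X i₁))) m)
    (b₂ : @BorelSpace X (@UniformSpace.toTopologicalSpace X
      (@PseudoEMetricSpace.toUniformSpace X (@EMetricSpace.toPseudoEMetricSpace X i₂))) m)
    (h : ∀ x y : X, @edist X (@PseudoEMetricSpace.toEDist X (@EMetricSpace.toPseudoEMetricSpace X i₂))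
      x y = @edist X (@PseudoEMetricSpace.toEDist X (@EMetricSpace.toPseudoEMetricSpace X i₁)) x y)
    {d : ℝ} (hd : 0 ≤ d) (s : Set X) :
    @hausdorffMeasure X i₁ m b₁ d s = @hausdorffMeasure X i₂ m b₂ d s := by
  have hiso : @Isometry X X (@EMetricSpace.toPseudoEMetricSpace X i₁)
      (@EMetricSpace.toPseudoEMetricSpace X i₂) id := fun x y ↦ h x y
  have h2 := @Isometry.hausdorffMeasure_image X X i₁ i₂ m b₁ m b₂ id d hiso (Or.inl hd) s
  rw [Set.image_id] at h2
  exact h2.symm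

/-- The `ContMDiffRiemannianMetric` of Euclidean `ℝ⁴` (the argument of `riemannianMeasure` in
the crux, for `g = euclideanMetric EuclideanFour`). [folklore] -/
abbrev euclideanFourMetric :
    ContMDiffRiemannianMetric 𝓘(ℝ, EuclideanFour) ∞ EuclideanFour
      (TangentSpace 𝓘(ℝ, EuclideanFour) : EuclideanFour → Type _) :=
  (euclideanMetric EuclideanFour).toContMDiffRiemannianMetric isRiemannian_euclideanMetric

/-- The Riemannian emetric structure of Euclidean `ℝ⁴` (the one inside `riemannianMeasure`,
spelled exactly as in `Literature.Geometry.Lorentzian.riemannianVolume`). [folklore] -/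
@[reducible] def euclideanFourEMetric : EMetricSpace EuclideanFour :=
  letI : RiemannianBundle (fun x : EuclideanFour ↦ TangentSpace 𝓘(ℝ, EuclideanFour) x) :=
    ⟨euclideanFourMetric.toContinuousRiemannianMetric.toRiemannianMetric⟩
  EMetricSpace.ofRiemannianMetric 𝓘(ℝ, EuclideanFour) EuclideanFour

/-- Unfolding `riemannianMeasure` of Euclidean `ℝ⁴` to `μHE[dim]` of `euclideanFourEMetric`. [folklore] -/
theorem riemannianMeasure_euclideanFour_def :
    riemannianMeasure euclideanFourMetric =
      @euclideanHausdorffMeasure EuclideanFour euclideanFourEMetric _ (by exact inferInstanceAs (BorelSpace EuclideanFour))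
        (Module.finrank ℝ EuclideanFour) := rfl

/-- The Riemannian distance of `euclideanFourEMetric` is the Euclidean distance. [folklore] -/
theorem edist_euclideanFourEMetric (x y : EuclideanFour) :
    @edist EuclideanFour (@PseudoEMetricSpace.toEDist EuclideanFour (@EMetricSpace.toPseudoEMetricSpace EuclideanFour euclideanFourEMetric)) x y
      = edist x y := by
  rw [IsRiemannianManifold.out (I := 𝓘(ℝ, EuclideanFour)) x y]
  rfl

/-- **The Riemannian measure of Euclidean `ℝ⁴` is Lebesgue measure** (`dV_δ = dx`; Federer 1969,
§3.2.46 in the flat case: the Euclidean-normalised Hausdorff measure of `ℝ⁴` is `volume`). [folklore] -/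
theorem riemannianMeasure_euclideanFour : riemannianMeasure euclideanFourMetric = (volume : Measure EuclideanFour) := by
  rw [riemannianMeasure_euclideanFour_def, ← InnerProductSpace.euclideanHausdorffMeasure_eq_volume (V := EuclideanFour)]
  refine Measure.ext fun s _ ↦ ?_
  rw [@euclideanHausdorffMeasure_def EuclideanFour euclideanFourEMetric _ (by exact inferInstanceAs (BorelSpace EuclideanFour)),
    euclideanHausdorffMeasure_def, Measure.smul_apply, Measure.smul_apply,
    hausdorffMeasure_eq_of_edist_eq euclideanFourEMetric _ _ _
      (fun x y ↦ (edist_euclideanFourEMetric x y).symm) (Nat.cast_nonneg _) s]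

/-! ### Stage G: the Gaussian integral on `ℝ⁴` and the numerical comparison -/

/-- **The Gaussian integral on `ℝ⁴`**: `∫ e^{-|x|²/4} dx = (4π)² = 16π²`. [folklore] -/
theorem integral_exp_neg_gaussianPotential : ∫ v : EuclideanFour, Real.exp (-gaussianPotential v) = 16 * Real.pi ^ 2 := by
  have h := GaussianFourier.integral_rexp_neg_mul_sq_norm (V := EuclideanFour) (b := 1 / 4) (by norm_num)
  have hfun : (fun v : EuclideanFour ↦ Real.exp (-gaussianPotential v)) = fun v ↦ Real.exp (-(1 / 4) * ‖v‖ ^ 2) := by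
    funext v; simp only [gaussianPotential]; ring_nf
  rw [hfun, h, finrank_euclideanSpace_fin]
  have h2 : ((4 : ℕ) : ℝ) / 2 = (2 : ℕ) := by norm_num
  rw [h2, Real.rpow_natCast]
  ring

/-- The Gaussian integral on `ℝ⁴` as a lower Lebesgue integral (the crux's left-hand side for the
Gaussian shrinker): `∫⁻ e^{-|x|²/4} dx = 16π²`. [folklore] -/
theorem lintegral_exp_neg_gaussianPotential :
    ∫⁻ v : EuclideanFour, ENNReal.ofReal (Real.exp (-gaussianPotential v)) = ENNReal.ofReal (16 * Real.pi ^ 2) := by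
  have hint : Integrable (fun v : EuclideanFour ↦ Real.exp (-gaussianPotential v)) :=
    Integrable.of_integral_ne_zero (by rw [integral_exp_neg_gaussianPotential]; positivity)
  rw [← integral_exp_neg_gaussianPotential, ofReal_integral_eq_lintegral_ofReal hint
    (ae_of_all _ fun v ↦ (Real.exp_pos _).le)]

/-- `2 √π < e^{3/2}` (compare squares: `4π < 12.6 < 20.08 < e³`). [folklore] -/
theorem two_sqrt_pi_lt_exp : 2 * Real.sqrt Real.pi < Real.exp (3 / 2) := by
  have hπ := Real.pi_pos
  have he : (2.7182818283 : ℝ) < Real.exp 1 := Real.exp_one_gt_d9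
  have he3 : (2.7182818283 : ℝ) ^ 3 < Real.exp 1 ^ 3 :=
    pow_lt_pow_left₀ he (by norm_num) (by norm_num)
  have hsq : (2 * Real.sqrt Real.pi) ^ 2 < Real.exp (3 / 2) ^ 2 := by
    rw [mul_pow, Real.sq_sqrt hπ.le, ← Real.exp_nat_mul]
    have h3 : ((2 : ℕ) : ℝ) * (3 / 2) = (3 : ℕ) * 1 := by norm_num
    rw [h3, Real.exp_nat_mul]
    have hpi : Real.pi < 3.15 := Real.pi_lt_d2
    nlinarith [he3, hpi]
  exact lt_of_pow_lt_pow_left₀ 2 (Real.exp_pos _).le hsq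

/-- **The Gaussian beats the cylinder bound**: `32π²√π e^{-3/2} < 16π²`, i.e.
`Θ(S³×ℝ) = 2√π e^{-3/2} ≈ .791 < 1 = Θ(ℝ⁴)`. [folklore] -/
theorem cylinderDensityBound_lt_gaussian :
    32 * Real.pi ^ 2 * Real.sqrt Real.pi * Real.exp (-(3 : ℝ) / 2) < 16 * Real.pi ^ 2 := by
  have hπ := Real.pi_pos
  rw [show (-(3 : ℝ) / 2) = -(3 / 2) by ring, Real.exp_neg, mul_inv_lt_iff₀ (Real.exp_pos _)]
  calc 32 * Real.pi ^ 2 * Real.sqrt Real.pi = 16 * Real.pi ^ 2 * (2 * Real.sqrt Real.pi) := by ring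
    _ < 16 * Real.pi ^ 2 * Real.exp (3 / 2) :=
      mul_lt_mul_of_pos_left two_sqrt_pi_lt_exp (by positivity)

end EuclideanFour

end General

end Literature.Geometry.Riemannian

end
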